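import Literature.Computability.AlgebraicComplexity.BI17FundamentalInvariantForms
import Literature.Computability.AlgebraicComplexity.PolystabilityProofs
import HarnessLib

/-!
# A polystable nonzero form has a finite stabilizer period (Bürgisser–Ikenmeyer 2017, Prop. 2.11):
# discharge

Sibling proof file of `Literature/Computability/AlgebraicComplexity/BI17FundamentalInvariantForms.lean`
(cell `val-lit`, DAG row BI17-A), discharging its named fact
`Literature.Computability.AlgebraicComplexity.BI2017_prop_2_11`: for a form `f ∈ Sym^D ℂ^m` with
`D ≥ 1`, `f ≠ 0` and `f` polystable (its `SL_m`-orbit Zariski closed, `IsPolystable`), the stabilizer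
period `a(f) = |det(stab(f))|` is finite (`stabilizerPeriod f ≠ 0` in the tree's `Nat.card` encoding,
`0` standing for `∞`) (P. Bürgisser, C. Ikenmeyer, *Fundamental invariants of orbit closures*,
J. Algebra 477 (2017) 390–434, Prop. 2.11: "A polystable nonzero form has a finite stabilizer
period"; arXiv:1511.02927 TeX L655, held text `paper:arxiv-1511.02927` p0007.txt:L82–95).

## Proof

Printed proof (p0007.txt:L84–95): if `det(stab(w)) = ℂ^×` there are `g_n ∈ stab(w)` with
`|det g_n| → ∞`; writing `g_n = t_n h_n`, `h_n ∈ SL_m`, gives `t_n^{-D} w = h_n w ∈ SL_m w`, and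
letting `n → ∞`, `0 ∈ \overline{SL_m w}`, so the orbit is not closed or `w = 0`. The step "infinite
`⇒ det(stab(w)) = ℂ^×`" uses that `det(stab(w))` is a Zariski-closed subgroup of `ℂ^×` (image of an
algebraic group), which is not available in Mathlib. We replace the limit argument by an algebraic
one that needs only "infinite":

1. If `det(stab(f))` is infinite then (taking `m`-th roots `t^m = det γ` and `h = t⁻¹ γ ∈ SL_m` as in
   print, `h · f = t^{-D} f` by homogeneity) the set `S` of scalars `c` with `c · f ∈ SL_m · f` is
   infinite: `c = t^{-D}` satisfies `c^{-m} = (det γ)^D`, and `z ↦ z^D` is finite-to-one on `ℂ^×`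
   (`key`, `infinite_scalars`).
2. Every polynomial `p` on coefficient space vanishing on the orbit `SL_m · f` vanishes at `0`: its
   restriction `c ↦ p(c · f)` to the line through `f` is a one-variable polynomial with infinitely
   many roots (`aeval_zero_of_vanishes`). Hence `0` lies in the Zariski closure of the orbit, which is
   the orbit itself (polystability), so `h · f = 0` for some `h ∈ SL_m`, i.e. `f = 0`.

(`m = 0`: `GL_0` is trivial and the period is `1`.) Everything is proved; no definitions, no named
facts, no `instance`, no `notation`.

## References

* [BurgisserIkenmeyer2017] P. Bürgisser, C. Ikenmeyer, J. Algebra 477 (2017) = arXiv:1511.02927,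
  §2.1 (stabilizer period, Def. 2.2), §2.2 Def. 2.7, Prop. 2.11 (TeX L655; held p0007.txt:L82–95).
-/

noncomputable section

open MvPolynomial

namespace Literature.Computability.AlgebraicComplexity

section PropTwoEleven

variable {m D : ℕ} {f : MvPolynomial (Fin m) ℂ}

/-- **Step 1 (the printed rescaling)**: every `z ∈ det(stab(f))` yields a scalar `c` with
`c · f ∈ SL_m · f` (in coefficient space) and `c^{-m} = z^D`: take `γ ∈ stab(f)` with `det γ = z`,
`t^m = z`, `h = t⁻¹ γ ∈ SL_m`, `c = t^{-D}`. [cite: BurgisserIkenmeyer2017, Prop. 2.11 (proof, TeX L655; held p0007.txt:L86–92)] -/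
private theorem exists_scalar_of_mem_stabilizerDetImage (hm : 0 < m) (hf : f.IsHomogeneous D)
    {z : ℂˣ} (hz : z ∈ stabilizerDetImage f) :
    ∃ c : ℂ, c • coeffVec f ∈ coeffVec '' slOrbit (Fin m) ℂ f ∧ (c⁻¹) ^ m = (z : ℂ) ^ D := by
  obtain ⟨γ, hγ, hdet⟩ := Subgroup.mem_map.mp hz
  have hγf : linSubst (Fin m) ℂ (γ : Matrix (Fin m) (Fin m) ℂ) f = f := by
    have := mem_linStabilizer.mp hγ
    rwa [linSubstRep_apply] at this
  obtain ⟨t, ht⟩ := IsAlgClosed.exists_pow_nat_eq (z : ℂ) hm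
  have ht0 : t ≠ 0 := by
    rintro rfl
    rw [zero_pow hm.ne'] at ht
    exact z.ne_zero ht.symm
  set A : Matrix (Fin m) (Fin m) ℂ := t⁻¹ • (γ : Matrix (Fin m) (Fin m) ℂ) with hA
  have hdetz : (γ : Matrix (Fin m) (Fin m) ℂ).det = (z : ℂ) := by
    rw [← Matrix.GeneralLinearGroup.val_det_apply, hdet]
  have hdetA : A.det = 1 := by
    rw [hA, Matrix.det_smul, Fintype.card_fin, hdetz, ← ht, inv_pow,
      inv_mul_cancel₀ (pow_ne_zero _ ht0)]
  refine ⟨(t ^ D)⁻¹, ⟨linSubst (Fin m) ℂ A f, ⟨⟨A, hdetA⟩, rfl⟩, ?_⟩, ?_⟩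
  · rw [hA, linSubst_smul_of_isHomogeneous hf, hγf, inv_pow]
    funext i
    simp [coeffVec_apply]
  · rw [inv_inv, ← pow_mul, mul_comm, pow_mul, ht]

/-- The fibres of `z ↦ z^D` on `ℂ^×` are finite (`D ≥ 1`: at most `D` roots of `X^D - w`).
[folklore] -/
private theorem finite_units_pow_eq (hD : 0 < D) (w : ℂ) : ({z : ℂˣ | (z : ℂ) ^ D = w}).Finite := by
  classical
  have h1 : {z : ℂˣ | (z : ℂ) ^ D = w} ⊆
      Units.val ⁻¹' (↑(Polynomial.nthRoots D w).toFinset : Set ℂ) := by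
    intro z hz
    simp only [Set.mem_preimage, Finset.mem_coe, Multiset.mem_toFinset]
    exact (Polynomial.mem_nthRoots hD).mpr hz
  exact ((Finset.finite_toSet _).preimage Units.val_injective.injOn).subset h1

/-- **Step 1, conclusion**: if `det(stab(f))` is infinite then so is the set of scalars `c` with
`c · f ∈ SL_m · f`. [cite: BurgisserIkenmeyer2017, Prop. 2.11 (proof)] -/
private theorem infinite_scalars (hm : 0 < m) (hD : 0 < D) (hf : f.IsHomogeneous D)
    (hH : ((stabilizerDetImage f : Subgroup ℂˣ) : Set ℂˣ).Infinite) :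
    {c : ℂ | c • coeffVec f ∈ coeffVec '' slOrbit (Fin m) ℂ f}.Infinite := by
  intro hSfin
  -- the `D`-th powers of the determinants form a finite set …
  have hH' : ((fun z : ℂˣ => (z : ℂ) ^ D) '' ((stabilizerDetImage f : Subgroup ℂˣ) : Set ℂˣ)).Finite := by
    refine (hSfin.image fun c : ℂ => (c⁻¹) ^ m).subset ?_
    rintro _ ⟨z, hz, rfl⟩
    obtain ⟨c, hcS, hc⟩ := exists_scalar_of_mem_stabilizerDetImage hm hf hz
    exact ⟨c, hcS, hc⟩
  -- … hence so do the determinants themselves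
  refine hH ((hH'.biUnion fun w _ => finite_units_pow_eq hD w).subset ?_)
  intro z hz
  simp only [Set.mem_iUnion, Set.mem_setOf_eq]
  exact ⟨(z : ℂ) ^ D, ⟨z, hz, rfl⟩, rfl⟩

/-- **Step 2**: if infinitely many scalar multiples of `f` lie in `SL_m · f`, then every polynomial on
coefficient space vanishing on the orbit vanishes at `0` (its restriction to the line `ℂ · f` is a
one-variable polynomial with infinitely many roots). [folklore] -/
private theorem aeval_zero_of_vanishes
    (hS : {c : ℂ | c • coeffVec f ∈ coeffVec '' slOrbit (Fin m) ℂ f}.Infinite)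
    (p : MvPolynomial (Fin m →₀ ℕ) ℂ) (hp : ∀ y ∈ coeffVec '' slOrbit (Fin m) ℂ f, aeval y p = 0) :
    aeval (0 : (Fin m →₀ ℕ) → ℂ) p = 0 := by
  set v₀ : (Fin m →₀ ℕ) → ℂ := coeffVec f with hv₀
  set Q : Polynomial ℂ :=
    MvPolynomial.aeval (fun i : Fin m →₀ ℕ => Polynomial.X * Polynomial.C (v₀ i)) p with hQ
  have hQeval : ∀ c : ℂ, Polynomial.eval c Q = aeval (c • v₀) p := by
    intro c
    have hfun : (fun i : Fin m →₀ ℕ =>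
        (Polynomial.aeval c) (Polynomial.X * Polynomial.C (v₀ i))) = c • v₀ := by
      funext i
      rw [map_mul, Polynomial.aeval_X, Polynomial.aeval_C, Algebra.algebraMap_self, RingHom.id_apply,
        Pi.smul_apply, smul_eq_mul]
    rw [hQ, ← Polynomial.coe_aeval_eq_eval, ← AlgHom.comp_apply, MvPolynomial.comp_aeval, hfun]
  have hroots : Set.Infinite {c : ℂ | Q.IsRoot c} := by
    refine hS.mono fun c hc => ?_
    show Q.IsRoot c
    rw [Polynomial.IsRoot, hQeval]
    exact hp _ hc
  have hQ0 : Q = 0 := Polynomial.eq_zero_of_infinite_isRoot Q hroots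
  have h := hQeval 0
  rw [hQ0, Polynomial.eval_zero, zero_smul] at h
  exact h.symm

end PropTwoEleven

/-! ### The discharge -/

/-- **Bürgisser–Ikenmeyer 2017, Prop. 2.11, discharged**: a polystable nonzero form of degree
`D ≥ 1` has a finite stabilizer period (`stabilizerPeriod f ≠ 0`, i.e. `det(stab(f)) ≤ ℂ^×` is
finite). If `det(stab(f))` were infinite, infinitely many scalar multiples `c · f` would lie in the
orbit `SL_m · f` (printed rescaling `g = t·h`, `h · f = t^{-D} f`), so every polynomial vanishing on
the orbit would vanish at `0`; the orbit being Zariski closed, `0 = h · f` for some `h ∈ SL_m`, i.e.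
`f = 0`. (This replaces the printed limit `|det g_n| → ∞`, which needs `det(stab(f))` to be a closed
subgroup of `ℂ^×`.) [cite: BurgisserIkenmeyer2017, Prop. 2.11 (TeX L655; held paper:arxiv-1511.02927 p0007.txt:L82–95)] -/
theorem BI2017_prop_2_11_holds : BI2017_prop_2_11 := by
  intro m D f hD hf hf0 hpoly hper
  classical
  -- `det(stab(f))` is infinite
  have hH : ((stabilizerDetImage f : Subgroup ℂˣ) : Set ℂˣ).Infinite := by
    rw [stabilizerPeriod_def] at hper
    rcases Nat.card_eq_zero.mp hper with h | h
    · exact (h.false (⟨1, one_mem _⟩ : stabilizerDetImage f)).elim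
    · exact Set.infinite_coe_iff.mp h
  -- `m = 0`: `GL_0` is trivial, the determinant image is `{1}`
  rcases Nat.eq_zero_or_pos m with hm0 | hm
  · subst hm0
    refine hH ((Set.finite_singleton (1 : ℂˣ)).subset ?_)
    intro u hu
    obtain ⟨γ, -, hdet⟩ := Subgroup.mem_map.mp hu
    rw [Set.mem_singleton_iff, ← hdet]
    exact Units.ext (by simp [Matrix.GeneralLinearGroup.val_det_apply, Matrix.det_isEmpty])
  -- `m ≥ 1`: `0` lies in the Zariski closure of the orbit, hence in the orbit
  have h0 : (0 : (Fin m →₀ ℕ) → ℂ) ∈ zariskiClosure (coeffVec '' slOrbit (Fin m) ℂ f) :=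
    mem_zariskiClosure_iff.mpr (aeval_zero_of_vanishes (infinite_scalars hm hD hf hH))
  obtain ⟨h, ⟨g, rfl⟩, hh⟩ := hpoly h0
  have hzero : linSubst (Fin m) ℂ (g : Matrix (Fin m) (Fin m) ℂ) f = 0 :=
    coeffVec_injective (by rw [hh]; funext d; simp [coeffVec_apply])
  apply hf0
  have h1 : linSubst (Fin m) ℂ
      (Matrix.adjugate (g : Matrix (Fin m) (Fin m) ℂ) * (g : Matrix (Fin m) (Fin m) ℂ)) f = f := by
    rw [Matrix.adjugate_mul, g.2, one_smul, linSubst_one]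
    rfl
  rw [linSubst_mul, AlgHom.comp_apply, hzero, map_zero] at h1
  exact h1.symm

end Literature.Computability.AlgebraicComplexity

end
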